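import Summits.HodgeConjecture.HodgeConjecture.Theorems.F0P3bCharDistReduction
import Literature.NumberTheory.Rogawski1990.FinExplicitTransferFactorConjRight
import Literature.NumberTheory.Rogawski1990.CharIdentityOnTestFunctionsSignedLemmas
import Literature.NumberTheory.Automorphic.SmoothCharacterOfCharacter
import Literature.NumberTheory.Automorphic.LocalHermitianFormSign
import Literature.NumberTheory.Automorphic.UnitaryGroupPrincipalSeriesH
import HarnessLib

/-!
# R90 · S3 · hand p02 «A1-steinberg» — the endoscopic expansion of a STEINBERG-TYPE `H_v`-packet [Rogawski1990, Prop. 13.1.3 (d) p. 199]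

R90-TF SLAB (brief v2 1f40d54518340a35), section S3 (Ch. 12–13 non-archimedean character identities), dealer R90-C12-plan (g0), DEAL
`R90/S3/DEAL-S3-WAVE1.R90-C12-plan-g0.md` 708593ee0d0a3c33 hand **p02 «A1-steinberg ∕ semi-regular»** (ROAD «REDUCE TO THE L4 LEAF `stub_StCharTS` SHAPE»);
seat R90-C14-p02 (g0) (freed S6 hand, LEAD #17 cross-section re-deal); census `R90/R90-C14-p02/g0/CENSUS-A1-steinberg.md` bde6207db8adfcbc;
crux H413 = `stmt-HodgeConjecture-24833`, route `HCCMUnconditional`, lane `--supports … --as helper`.  One theorem; no definition, no instance,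
no notation, no `sorry`; imports ★ Literature ∕ Theorems only (no `Lines` file — CONVENTIONS §2, R-S3-1).

THE CLAUSE.  Socket A1 `R90_S3_EndoCharIdentityA.stub_R90_S3_endoExpansion_exists` asks, at the RECORD local data (right Haar measures `νG νH`,
canonical orbital families `mH mG`, transfer factor of record `Δ‴_v = finExplicitCollection L H′ μ … v`, non-split `v`), for every Rogawski `H_v`-packet
`ρ` an INTEGER-valued expansion `c` with `Σ_{σ∈ρ} Tr σ(f^H) = Σ_π c(π) Tr π(f)` on `Δ‴_v`-matched test pairs (`R90.S3.IsEndoExpansion`, UNFOLDED here byte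
for byte from tree `R90_S3_EndoFibreDefsC.lean` :87–:91, as in the p01 file of record `R90S3EndoExpansionOneDim`).  This file pays the clause for the packets
ALL OF WHOSE MEMBERS ARE OF STEINBERG TYPE `St_H(ξ)` (§12.1 case 1), pp. 171–172: `σ` is the second constituent of a length-two principal series
`i_H(χ₂ ⊠ χ₁)` whose other constituent is ONE-DIMENSIONAL — ★ `UnitaryGroup.HLengthTwoLabels L v χ₂ χ₁ ⟦ℂ_Ξ⟧ σ`, ★ `SmoothIrrep.ofChar`; hypothesis `hSt`,
the «steinberg» TYPE SPELLING of the census), from print's Prop. 13.1.3 (d) ∕ Lemma 12.7.3 «`ξ_H(St_H(ξ)) = {π²(ξ), πˢ(ξ)}`, `πˢ(ξ)` supercuspidal,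
`Tr St_H(ξ)(f^H) = Tr π²(ξ)(f) − Tr πˢ(ξ)(f)`» READ SIGNED for the factor of record (`Δ‴_v = ε_v(H′)·Δ_v`, `ε_v(H′) = formSignAt L c H′ v ∈ {±1}`, ★
`LocalHermitianFormSign`; bridge to the frame sign `(a ∈ N(units) ? 1 : −1)` of the L4 leaf: ★ `formSignAt_eq_ite_of_formCongr`).  The printed identity is the
NAMED HYPOTHESIS `hTS`: for every Steinberg-type member `σ ∈ ρ` with its labels there are classes `π², πˢ` of `G_v` with
`Tr σ(f^H) = ε_v(H′)·(Tr π²(f) − Tr πˢ(f))` for all `Δ‴_v`-matched test pairs — honest: a printed local result (Prop. 13.1.3 (d)) which the tree holds ONLY as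
the registered, still open L4 leaf `F0U3LettersRung1.stub_StCharTS` (inner form, global `ξ`; NOT imported — L5); print's `πˢ` is moreover supercuspidal and
`≠ π²`, which the EXISTENCE of the expansion does not need, so `hTS` asks only for the identity (weakest printed input; `stub_StCharTS`'s conclusion gives it
by dropping two conjuncts, after the frame∕sign transport of S3 FILE B §1).

THE PROOF.  Per member `σ ∈ ρ`: labels from `hSt`, then `hTS` gives `π², πˢ` and the signed identity, so `c_σ := single π² ε + single πˢ (−ε) ∈ ℤ[Irr G_v]`
(`ε = formSignAt … ∈ ℤ`) is an expansion of `{σ}` (`Finsupp.sum_add_index'`, `Finsupp.sum_single_index`); summing over the members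
(`Finsupp.sum_finsetSum_index`) gives `c := Σ_{σ∈ρ} c_σ`.  The record side conditions of A1 (`hH′ hH′d hμu hμω hv hm hT`) and the packet hypothesis
`hρ : IsRogPacketH L v ρ` are not used by this clause and are therefore not binders (pattern of record, p01 RULING «=» 15:49:10Z): the theorem holds for every
finite set `ρ` of Steinberg-type classes GIVEN `hTS`.  File A ED. 2 ∕ the S3 assembly close the Steinberg case by
`exact endoExpansion_exists_of_steinberg L H′ v μ νG νH mH mG ρ hSt hTS` (δ-unfolding `IsEndoExpansion`).

HONEST LABEL: HC_CM is proved only modulo the 7 printed citations (2 remaining named inputs: hLiu418 = stmt-HodgeConjecture-24832, h413 = stmt-HodgeConjecture-24833)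
until rung 0 closes; this file proves the Steinberg-type A1 clause CONDITIONALLY on the printed Prop. 13.1.3 (d) (named hypothesis `hTS`); REL ≠ ★ ≠ BUILT.

## References
* [Rogawski1990] J. D. Rogawski, *Automorphic Representations of Unitary Groups in Three Variables*, Ann. of Math. Stud. 123 (1990): §13.1 Thm. 13.1.1 (2)
  p. 198, Prop. 13.1.3 (d) p. 199; §12.7 Lemma 12.7.3 p. 195; §12.1 pp. 171–172 (`JH(i_H(χ)) = {ξ, St_H(ξ)}`); §4.9 p. 55 (local transfer); §14.6 p. 242 (the sign `c_v`).
-/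

set_option autoImplicit false
-- the mandated namespace repeats the single-problem summit's segment (`HodgeConjecture.HodgeConjecture`)
set_option linter.dupNamespace false

noncomputable section

namespace Summit.HodgeConjecture.HodgeConjecture.R90.S3

open MeasureTheory IsDedekindDomain NumberField
open Literature.NumberTheory Literature.NumberTheory.Automorphic Literature.NumberTheory.Automorphic.UnitaryGroup
open Literature.NumberTheory.Rogawski1990 Literature.NumberTheory.GaloisRepresentations
open scoped Matrix

variable (L : Type) [Field L] [NumberField L] [IsCMField L] (H' : Matrix (Fin 3) (Fin 3) L)
  (v : HeightOneSpectrum (𝓞 ↥(maximalRealSubfield L)))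

/-- **A1 for STEINBERG-TYPE `H_v`-packets [Prop. 13.1.3 (d)].**  At the record local data of socket A1, for a finite set `ρ` of classes of `H_v`
all of which are of Steinberg type `St_H(ξ)` (`hSt`: `σ` is the partner of a one-dimensional class `⟦ℂ_Ξ⟧` in a length-two principal series
`i_H(χ₂ ⊠ χ₁)`, ★ `HLengthTwoLabels`), GIVEN print's signed identity [13.1.3 (d) ∕ 12.7.3] for each member at the factor of record
(`hTS`: `Tr σ(f^H) = ε_v(H′)·(Tr π²(f) − Tr πˢ(f))` on `Δ‴_v`-matched test pairs), there is an integer expansion `c = Σ_{σ∈ρ} ε_v(H′)·(1·π²_σ − 1·πˢ_σ)`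
with `Σ_{σ∈ρ} Tr σ(f^H) = Σ_π c(π) Tr π(f)` for every `Δ‴_v`-matched pair of test functions.
[cite: Rogawski1990, §13.1 Prop. 13.1.3 (d) p. 199; Thm. 13.1.1 (2) p. 198; §12.7 Lemma 12.7.3 p. 195; §12.1 pp. 171–172; §14.6 p. 242] -/
theorem endoExpansion_exists_of_steinberg
    (μ : HeckeCharacter L)
    [MeasurableSpace ((UnitaryGroup.cmDatum L 3 H').Local v)] [BorelSpace ((UnitaryGroup.cmDatum L 3 H').Local v)]
    [MeasurableSpace ((UnitaryGroup.cmDatum L 2 (Matrix.of fun i j : Fin 2 => if i.val + j.val + 1 = 2 then (1 : L) else 0)).Local v ×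
      (UnitaryGroup.cmDatum L 1 (Matrix.of fun i j : Fin 1 => if i.val + j.val + 1 = 1 then (1 : L) else 0)).Local v)]
    [BorelSpace ((UnitaryGroup.cmDatum L 2 (Matrix.of fun i j : Fin 2 => if i.val + j.val + 1 = 2 then (1 : L) else 0)).Local v ×
      (UnitaryGroup.cmDatum L 1 (Matrix.of fun i j : Fin 1 => if i.val + j.val + 1 = 1 then (1 : L) else 0)).Local v)]
    [∀ a : ((UnitaryGroup.cmDatum L 2 (Matrix.of fun i j : Fin 2 => if i.val + j.val + 1 = 2 then (1 : L) else 0)).Local v ×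
      (UnitaryGroup.cmDatum L 1 (Matrix.of fun i j : Fin 1 => if i.val + j.val + 1 = 1 then (1 : L) else 0)).Local v),
      MeasurableSpace (((UnitaryGroup.cmDatum L 2 (Matrix.of fun i j : Fin 2 => if i.val + j.val + 1 = 2 then (1 : L) else 0)).Local v ×
      (UnitaryGroup.cmDatum L 1 (Matrix.of fun i j : Fin 1 => if i.val + j.val + 1 = 1 then (1 : L) else 0)).Local v) ⧸
        Subgroup.centralizer ({a} : Set ((UnitaryGroup.cmDatum L 2 (Matrix.of fun i j : Fin 2 => if i.val + j.val + 1 = 2 then (1 : L) else 0)).Local v ×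
      (UnitaryGroup.cmDatum L 1 (Matrix.of fun i j : Fin 1 => if i.val + j.val + 1 = 1 then (1 : L) else 0)).Local v)))]
    [∀ a : ((UnitaryGroup.cmDatum L 2 (Matrix.of fun i j : Fin 2 => if i.val + j.val + 1 = 2 then (1 : L) else 0)).Local v ×
      (UnitaryGroup.cmDatum L 1 (Matrix.of fun i j : Fin 1 => if i.val + j.val + 1 = 1 then (1 : L) else 0)).Local v),
      BorelSpace (((UnitaryGroup.cmDatum L 2 (Matrix.of fun i j : Fin 2 => if i.val + j.val + 1 = 2 then (1 : L) else 0)).Local v ×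
      (UnitaryGroup.cmDatum L 1 (Matrix.of fun i j : Fin 1 => if i.val + j.val + 1 = 1 then (1 : L) else 0)).Local v) ⧸
        Subgroup.centralizer ({a} : Set ((UnitaryGroup.cmDatum L 2 (Matrix.of fun i j : Fin 2 => if i.val + j.val + 1 = 2 then (1 : L) else 0)).Local v ×
      (UnitaryGroup.cmDatum L 1 (Matrix.of fun i j : Fin 1 => if i.val + j.val + 1 = 1 then (1 : L) else 0)).Local v)))]
    [∀ γ : ((UnitaryGroup.cmDatum L 3 H').Local v), MeasurableSpace (((UnitaryGroup.cmDatum L 3 H').Local v) ⧸ Subgroup.centralizer ({γ} : Set ((UnitaryGroup.cmDatum L 3 H').Local v)))]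
    [∀ γ : ((UnitaryGroup.cmDatum L 3 H').Local v), BorelSpace (((UnitaryGroup.cmDatum L 3 H').Local v) ⧸ Subgroup.centralizer ({γ} : Set ((UnitaryGroup.cmDatum L 3 H').Local v)))]
    (νG : Measure ((UnitaryGroup.cmDatum L 3 H').Local v)) [νG.IsHaarMeasure] [νG.IsMulRightInvariant]
    (νH : Measure ((UnitaryGroup.cmDatum L 2 (Matrix.of fun i j : Fin 2 => if i.val + j.val + 1 = 2 then (1 : L) else 0)).Local v ×
      (UnitaryGroup.cmDatum L 1 (Matrix.of fun i j : Fin 1 => if i.val + j.val + 1 = 1 then (1 : L) else 0)).Local v))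
    [νH.IsHaarMeasure] [νH.IsMulRightInvariant]
    (mH : OrbitalMeasureFamily ((UnitaryGroup.cmDatum L 2 (Matrix.of fun i j : Fin 2 => if i.val + j.val + 1 = 2 then (1 : L) else 0)).Local v ×
      (UnitaryGroup.cmDatum L 1 (Matrix.of fun i j : Fin 1 => if i.val + j.val + 1 = 1 then (1 : L) else 0)).Local v))
    (mG : OrbitalMeasureFamily ((UnitaryGroup.cmDatum L 3 H').Local v))
    (ρ : Finset (IrrClass ((UnitaryGroup.cmDatum L 2 (Matrix.of fun i j : Fin 2 => if i.val + j.val + 1 = 2 then (1 : L) else 0)).Local v ×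
      (UnitaryGroup.cmDatum L 1 (Matrix.of fun i j : Fin 1 => if i.val + j.val + 1 = 1 then (1 : L) else 0)).Local v)))
    (hSt : ∀ σ ∈ ρ, ∃ (χ₂ : ↥(torusU (conjLocal L (IsCMField.complexConj L) v) (cmLocalForm L 2 v)) →* ℂˣ)
        (χ₁ : (UnitaryGroup.cmDatum L 1 (Matrix.of fun i j : Fin 1 => if i.val + j.val + 1 = 1 then (1 : L) else 0)).Local v →* ℂˣ)
        (Ξ : (UnitaryGroup.cmDatum L 2 (Matrix.of fun i j : Fin 2 => if i.val + j.val + 1 = 2 then (1 : L) else 0)).Local v ×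
        (UnitaryGroup.cmDatum L 1 (Matrix.of fun i j : Fin 1 => if i.val + j.val + 1 = 1 then (1 : L) else 0)).Local v →* ℂˣ)
        (hΞ : IsOpen ((Ξ.ker : Subgroup ((UnitaryGroup.cmDatum L 2 (Matrix.of fun i j : Fin 2 => if i.val + j.val + 1 = 2 then (1 : L) else 0)).Local v ×
        (UnitaryGroup.cmDatum L 1 (Matrix.of fun i j : Fin 1 => if i.val + j.val + 1 = 1 then (1 : L) else 0)).Local v)) :
          Set ((UnitaryGroup.cmDatum L 2 (Matrix.of fun i j : Fin 2 => if i.val + j.val + 1 = 2 then (1 : L) else 0)).Local v ×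
        (UnitaryGroup.cmDatum L 1 (Matrix.of fun i j : Fin 1 => if i.val + j.val + 1 = 1 then (1 : L) else 0)).Local v))),
        HLengthTwoLabels L v χ₂ χ₁ (IrrClass.mk (SmoothIrrep.ofChar Ξ hΞ)) σ)
    (hTS : ∀ σ ∈ ρ, ∀ (χ₂ : ↥(torusU (conjLocal L (IsCMField.complexConj L) v) (cmLocalForm L 2 v)) →* ℂˣ)
        (χ₁ : (UnitaryGroup.cmDatum L 1 (Matrix.of fun i j : Fin 1 => if i.val + j.val + 1 = 1 then (1 : L) else 0)).Local v →* ℂˣ)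
        (Ξ : (UnitaryGroup.cmDatum L 2 (Matrix.of fun i j : Fin 2 => if i.val + j.val + 1 = 2 then (1 : L) else 0)).Local v ×
        (UnitaryGroup.cmDatum L 1 (Matrix.of fun i j : Fin 1 => if i.val + j.val + 1 = 1 then (1 : L) else 0)).Local v →* ℂˣ)
        (hΞ : IsOpen ((Ξ.ker : Subgroup ((UnitaryGroup.cmDatum L 2 (Matrix.of fun i j : Fin 2 => if i.val + j.val + 1 = 2 then (1 : L) else 0)).Local v ×
        (UnitaryGroup.cmDatum L 1 (Matrix.of fun i j : Fin 1 => if i.val + j.val + 1 = 1 then (1 : L) else 0)).Local v)) :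
          Set ((UnitaryGroup.cmDatum L 2 (Matrix.of fun i j : Fin 2 => if i.val + j.val + 1 = 2 then (1 : L) else 0)).Local v ×
        (UnitaryGroup.cmDatum L 1 (Matrix.of fun i j : Fin 1 => if i.val + j.val + 1 = 1 then (1 : L) else 0)).Local v))),
        HLengthTwoLabels L v χ₂ χ₁ (IrrClass.mk (SmoothIrrep.ofChar Ξ hΞ)) σ →
          ∃ π2 πs : IrrClass ((UnitaryGroup.cmDatum L 3 H').Local v),
            ∀ (fH : (UnitaryGroup.cmDatum L 2 (Matrix.of fun i j : Fin 2 => if i.val + j.val + 1 = 2 then (1 : L) else 0)).Local v ×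
        (UnitaryGroup.cmDatum L 1 (Matrix.of fun i j : Fin 1 => if i.val + j.val + 1 = 1 then (1 : L) else 0)).Local v → ℂ)
              (f : (UnitaryGroup.cmDatum L 3 H').Local v → ℂ),
              IsLocSmooth fH → IsLocSmooth f →
                IsLocalDeltaTransfer L H' v
                  (finExplicitCollection L H' μ (finExplicitDelta_conj_left_all L H' μ) (finExplicitDelta_conj_right_all L H' μ) v) mH mG fH f →
                σ.smoothTrace νH fH =
                  ((formSignAt L (IsCMField.complexConj L) H' v : ℤ) : ℂ) * (π2.smoothTrace νG f - πs.smoothTrace νG f)) :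
    ∃ c : IrrClass ((UnitaryGroup.cmDatum L 3 H').Local v) →₀ ℤ,
      ∀ (fH : (UnitaryGroup.cmDatum L 2 (Matrix.of fun i j : Fin 2 => if i.val + j.val + 1 = 2 then (1 : L) else 0)).Local v ×
        (UnitaryGroup.cmDatum L 1 (Matrix.of fun i j : Fin 1 => if i.val + j.val + 1 = 1 then (1 : L) else 0)).Local v → ℂ)
        (f : (UnitaryGroup.cmDatum L 3 H').Local v → ℂ),
        IsLocSmooth fH → IsLocSmooth f →
          IsLocalDeltaTransfer L H' v
            (finExplicitCollection L H' μ (finExplicitDelta_conj_left_all L H' μ) (finExplicitDelta_conj_right_all L H' μ) v) mH mG fH f →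
          ∑ σ ∈ ρ, σ.smoothTrace νH fH = ∑ π ∈ c.support, (c π : ℂ) * π.smoothTrace νG f := by
  classical
  -- bookkeeping for `Finsupp.sum` against `π ↦ n ↦ (n : ℂ) * Tr π(f)`
  have h0 : ∀ (f : (UnitaryGroup.cmDatum L 3 H').Local v → ℂ) (π : IrrClass ((UnitaryGroup.cmDatum L 3 H').Local v)),
      (((0 : ℤ) : ℤ) : ℂ) * π.smoothTrace νG f = 0 := fun f π => by simp
  have hadd : ∀ (f : (UnitaryGroup.cmDatum L 3 H').Local v → ℂ) (π : IrrClass ((UnitaryGroup.cmDatum L 3 H').Local v)) (m n : ℤ),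
      ((m + n : ℤ) : ℂ) * π.smoothTrace νG f = (m : ℂ) * π.smoothTrace νG f + (n : ℂ) * π.smoothTrace νG f := fun f π m n => by
    push_cast; ring
  -- STEP 1 (per member): `σ = St_H(ξ)` has the integer expansion `single π² ε + single πˢ (-ε)`, `ε = ε_v(H′)`
  have hmem : ∀ σ ∈ ρ, ∃ cσ : IrrClass ((UnitaryGroup.cmDatum L 3 H').Local v) →₀ ℤ,
      ∀ (fH : (UnitaryGroup.cmDatum L 2 (Matrix.of fun i j : Fin 2 => if i.val + j.val + 1 = 2 then (1 : L) else 0)).Local v ×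
        (UnitaryGroup.cmDatum L 1 (Matrix.of fun i j : Fin 1 => if i.val + j.val + 1 = 1 then (1 : L) else 0)).Local v → ℂ)
        (f : (UnitaryGroup.cmDatum L 3 H').Local v → ℂ), IsLocSmooth fH → IsLocSmooth f →
        IsLocalDeltaTransfer L H' v
          (finExplicitCollection L H' μ (finExplicitDelta_conj_left_all L H' μ) (finExplicitDelta_conj_right_all L H' μ) v) mH mG fH f →
        σ.smoothTrace νH fH = cσ.sum (fun π n => (n : ℂ) * π.smoothTrace νG f) := by
    intro σ hσ
    obtain ⟨χ₂, χ₁, Ξ, hΞ, hlab⟩ := hSt σ hσ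
    obtain ⟨π2, πs, hid⟩ := hTS σ hσ χ₂ χ₁ Ξ hΞ hlab
    refine ⟨Finsupp.single π2 (formSignAt L (IsCMField.complexConj L) H' v) +
      Finsupp.single πs (-formSignAt L (IsCMField.complexConj L) H' v), fun fH f hfH hf hΔ => ?_⟩
    have hsum : (Finsupp.single π2 (formSignAt L (IsCMField.complexConj L) H' v) +
          Finsupp.single πs (-formSignAt L (IsCMField.complexConj L) H' v)).sum (fun π n => (n : ℂ) * π.smoothTrace νG f) =
        ((formSignAt L (IsCMField.complexConj L) H' v : ℤ) : ℂ) * π2.smoothTrace νG f +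
          ((-formSignAt L (IsCMField.complexConj L) H' v : ℤ) : ℂ) * πs.smoothTrace νG f := by
      rw [Finsupp.sum_add_index' (h0 f) (hadd f), Finsupp.sum_single_index (h0 f π2), Finsupp.sum_single_index (h0 f πs)]
    rw [hsum, hid fH f hfH hf hΔ]
    push_cast
    ring
  -- STEP 2 (sum over the members): `c := Σ_{σ∈ρ} c_σ`
  choose! cf hcf using hmem
  refine ⟨∑ σ ∈ ρ, cf σ, fun fH f hfH hf hΔ => ?_⟩
  change _ = (∑ σ ∈ ρ, cf σ).sum (fun π n => (n : ℂ) * π.smoothTrace νG f)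
  rw [← Finsupp.sum_finsetSum_index (h0 f) (hadd f)]
  exact Finset.sum_congr rfl fun σ hσ => hcf σ hσ fH f hfH hf hΔ

end Summit.HodgeConjecture.HodgeConjecture.R90.S3

end
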